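import Summits.ValiantsHypothesis.ValiantsHypothesis.Theorems.SymPencilPerFourPeeledCornerSwapPairs
import Summits.ValiantsHypothesis.ValiantsHypothesis.Theorems.SymPencilPerFourPeeledCornerSwapSamePair
import Summits.ValiantsHypothesis.ValiantsHypothesis.Theorems.SymPencilPerFourPeeledTransport

/-!
# Route `SymPencil` — `2 | 2` inner rank of `per_4`, PEELED case at `≤ 11` squares: the
# DOUBLE-SWAP CORNER is EMPTY for EVERY pair of pairs (`--supports` stmt-ValiantsHypothesis-5674
# `SdcSuperquadratic`; (8,8) column, cell (8,8,11); memo `NOTE-p6g16-5674-corner-double-swap.md`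
# §1–§3 and Remark (iii) "S₄ acts on all four slots"; rung currency only)

**Theorem** (`false_of_double_swap`).  There is no reduced peeled family on `≤ 11` squares
(non-zero weights `c`, joint identity `Σ_r c_r t_r((a,b),(y,z))² = per(a;b;y;z)`, scalar outer
blocks along `v₀, v₀'`, peeled) whose two corrections are PURE SWAPS on arbitrary pairs:
`t(a,0)(x,0) = u₀(a_i x_j + a_j x_i)·v₀` (`i ≠ j`) and `t(0,b)(0,x) = u₁(b_k x_l + b_l x_k)·v₀'`
(`k ≠ l`).  Assembly: `transport_swap` moves the family along a simultaneous coordinate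
permutation `π` of all four slots (`per` is invariant, `…PeeledTransport.per_comp_perm`), turning the
pairs into `(π i, π j)`, `(π k, π l)`; `exists_perm_01` normalises `(i,j)` to `(0,1)`; then
`false_of_swap01` dispatches on `(k,l)`: the same pair is
`…CornerSwapSamePair.false_of_double_swap_same_pair` (val-lit-p6 g16), the pairs `{2,3}`, `{0,2}`
are `…CornerSwapPairs.false_of_swap01_core`, and `{0,3}`, `{1,2}`, `{1,3}` are moved onto `{0,2}` by
the permutations `(23)`, `(01)`, `(01)(23)`, which fix the pair `{0,1}`.  A matrix-currency
corollary `false_of_double_swap_matrix` (blocks `(aᵀΨx)·v₀`, `(bᵀΨ′x)·v₀′` with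
`Ψ = λ(E_ij + E_ji)`, `Ψ′ = λ′(E_kl + E_lk)`) is the form that composes with
`…TwoPencilFrameless.exists_frameless_pair_of_peeled` (val-lit-p8 g15).

Honest framing: this completes the CORNER of the (8,8,11) case analysis in the kernel; the cell
itself still needs the COVERAGE theorem "frameless ⇒ pure swap" (p8's atlas, memo
`NOTE-p8g15-5674-R2-two-pencil.md` §9); `28 ≤ sdc(per_4) ≤ 29` of record, the crux
`SdcSuperquadratic` and `VP ≠ VNP` are untouched.  No definitions, no named facts. [folklore]
-/

noncomputable section

-- single-conjunct layout: Sub = Summit, duplicated namespace component intended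
set_option linter.dupNamespace false

namespace Summit.ValiantsHypothesis.ValiantsHypothesis.Theorems.SymPencilPerFourPeeledCornerSwapAll

open Matrix Finset Module
open Summit.ValiantsHypothesis.ValiantsHypothesis.Theorems.SymPencilPerFourPeeledTransport
open Summit.ValiantsHypothesis.ValiantsHypothesis.Theorems.SymPencilPerFourPeeledCornerSwapSamePair
open Summit.ValiantsHypothesis.ValiantsHypothesis.Theorems.SymPencilPerFourPeeledCornerSwapPairs

universe u v

variable {K : Type u} [Field K]

/-- **Transport of a double-swap family along a coordinate permutation** (memo Remark (iii)):
`t'_r((a,b),(y,z)) := t_r((a∘π, b∘π),(y∘π, z∘π))` is again a reduced peeled family with the same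
weights and the same `v₀, v₀'`, and its two swap corrections sit on the pairs `(π i, π j)` and
`(π k, π l)`. [folklore] -/
theorem transport_swap {κ : Type v} [Fintype κ] (π : Equiv.Perm (Fin 4)) (c : κ → K)
    (t : κ → (((Fin 4 → K) × (Fin 4 → K)) →ₗ[K] ((Fin 4 → K) × (Fin 4 → K)) →ₗ[K] K))
    (hJ : ∀ a b y₂ y₃ : Fin 4 → K,
      ∑ r, c r * (t r (a, b) (y₂, y₃)) ^ 2 = (Matrix.of ![a, b, y₂, y₃]).permanent)
    (v₀ v₀' : κ → K) (hv₀ : ∀ (a x : Fin 4 → K), ∃ s : K, (fun r => t r (a, 0) (x, 0)) = s • v₀)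
    (hv₀' : ∀ (b x : Fin 4 → K), ∃ s : K, (fun r => t r (0, b) (0, x)) = s • v₀')
    (hpeel : ∃ a b y z : Fin 4 → K, ∑ r, c r * t r (a, 0) (y, 0) * t r (0, b) (0, z) ≠ 0)
    (u₀ u₁ : K) (i j k l : Fin 4)
    (hψ : ∀ (a x : Fin 4 → K) r, t r (a, 0) (x, 0) = u₀ * (a i * x j + a j * x i) * v₀ r)
    (hψ' : ∀ (b x : Fin 4 → K) r, t r (0, b) (0, x) = u₁ * (b k * x l + b l * x k) * v₀' r) :
    ∃ t' : κ → (((Fin 4 → K) × (Fin 4 → K)) →ₗ[K] ((Fin 4 → K) × (Fin 4 → K)) →ₗ[K] K),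
      (∀ a b y₂ y₃ : Fin 4 → K,
        ∑ r, c r * (t' r (a, b) (y₂, y₃)) ^ 2 = (Matrix.of ![a, b, y₂, y₃]).permanent) ∧
      (∀ (a x : Fin 4 → K), ∃ s : K, (fun r => t' r (a, 0) (x, 0)) = s • v₀) ∧
      (∀ (b x : Fin 4 → K), ∃ s : K, (fun r => t' r (0, b) (0, x)) = s • v₀') ∧
      (∃ a b y z : Fin 4 → K, ∑ r, c r * t' r (a, 0) (y, 0) * t' r (0, b) (0, z) ≠ 0) ∧
      (∀ (a x : Fin 4 → K) r,
        t' r (a, 0) (x, 0) = u₀ * (a (π i) * x (π j) + a (π j) * x (π i)) * v₀ r) ∧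
      (∀ (b x : Fin 4 → K) r,
        t' r (0, b) (0, x) = u₁ * (b (π k) * x (π l) + b (π l) * x (π k)) * v₀' r) := by
  classical
  let L : ((Fin 4 → K) × (Fin 4 → K)) →ₗ[K] ((Fin 4 → K) × (Fin 4 → K)) :=
    (LinearMap.funLeft K K π).prodMap (LinearMap.funLeft K K π)
  let t' : κ → (((Fin 4 → K) × (Fin 4 → K)) →ₗ[K] ((Fin 4 → K) × (Fin 4 → K)) →ₗ[K] K) :=
    fun r => (t r).compl₁₂ L L
  have ht' : ∀ r (a b y z : Fin 4 → K), t' r (a, b) (y, z) = t r (a ∘ π, b ∘ π) (y ∘ π, z ∘ π) :=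
    fun r a b y z => rfl
  have z0 : ((0 : Fin 4 → K) ∘ π) = 0 := rfl
  refine ⟨t', fun a b y₂ y₃ => ?_, fun a x => ?_, fun b x => ?_, ?_, fun a x r => ?_, fun b x r => ?_⟩
  · simp only [ht']
    rw [hJ, per_comp_perm]
  · obtain ⟨s, hs⟩ := hv₀ (a ∘ π) (x ∘ π)
    exact ⟨s, by simpa only [ht', z0] using hs⟩
  · obtain ⟨s, hs⟩ := hv₀' (b ∘ π) (x ∘ π)
    exact ⟨s, by simpa only [ht', z0] using hs⟩
  · obtain ⟨a, b, y, z, hne⟩ := hpeel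
    refine ⟨a ∘ π.symm, b ∘ π.symm, y ∘ π.symm, z ∘ π.symm, ?_⟩
    have hc : ∀ w : Fin 4 → K, (w ∘ π.symm) ∘ π = w := fun w => by
      funext i; simp
    simpa only [ht', z0, hc] using hne
  · simp only [ht', z0, hψ, Function.comp_apply]
  · simp only [ht', z0, hψ', Function.comp_apply]

/-- A permutation of `Fin 4` sending `i ↦ 0`, `j ↦ 1` (`i ≠ j`). [folklore] -/
theorem exists_perm_01 (i j : Fin 4) (hij : i ≠ j) :
    ∃ π : Equiv.Perm (Fin 4), π i = 0 ∧ π j = 1 := by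
  have h1 : Equiv.swap i 0 j ≠ 0 := by
    intro h
    apply hij
    have : Equiv.swap i 0 j = Equiv.swap i 0 i := by rw [h, Equiv.swap_apply_left]
    exact ((Equiv.swap i 0).injective this).symm
  refine ⟨Equiv.swap (Equiv.swap i 0 j) 1 * Equiv.swap i 0, ?_, ?_⟩
  · rw [Equiv.Perm.mul_apply, Equiv.swap_apply_left,
      Equiv.swap_apply_of_ne_of_ne h1.symm (by decide)]
  · rw [Equiv.Perm.mul_apply, Equiv.swap_apply_left]

/-- **Dispatch on the second pair** when the first swap sits on `{0,1}`. [folklore] -/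
theorem false_of_swap01 [CharZero K] {κ : Type v} [Fintype κ] [DecidableEq κ]
    (hκ : Fintype.card κ ≤ 11) (c : κ → K) (hc : ∀ r, c r ≠ 0)
    (t : κ → (((Fin 4 → K) × (Fin 4 → K)) →ₗ[K] ((Fin 4 → K) × (Fin 4 → K)) →ₗ[K] K))
    (hJ : ∀ a b y₂ y₃ : Fin 4 → K,
      ∑ r, c r * (t r (a, b) (y₂, y₃)) ^ 2 = (Matrix.of ![a, b, y₂, y₃]).permanent)
    (v₀ v₀' : κ → K) (hv₀ : ∀ (a x : Fin 4 → K), ∃ s : K, (fun r => t r (a, 0) (x, 0)) = s • v₀)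
    (hv₀' : ∀ (b x : Fin 4 → K), ∃ s : K, (fun r => t r (0, b) (0, x)) = s • v₀')
    (hpeel : ∃ a b y z : Fin 4 → K, ∑ r, c r * t r (a, 0) (y, 0) * t r (0, b) (0, z) ≠ 0)
    (u₀ u₁ : K) (k l : Fin 4) (hkl : k ≠ l)
    (hψ : ∀ (a x : Fin 4 → K) r, t r (a, 0) (x, 0) = u₀ * (a 0 * x 1 + a 1 * x 0) * v₀ r)
    (hψ' : ∀ (b x : Fin 4 → K) r, t r (0, b) (0, x) = u₁ * (b k * x l + b l * x k) * v₀' r) :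
    False := by
  -- the six pairs with `k < l`
  have norm : ∀ (t : κ → (((Fin 4 → K) × (Fin 4 → K)) →ₗ[K] ((Fin 4 → K) × (Fin 4 → K)) →ₗ[K] K)),
      (∀ a b y₂ y₃ : Fin 4 → K,
        ∑ r, c r * (t r (a, b) (y₂, y₃)) ^ 2 = (Matrix.of ![a, b, y₂, y₃]).permanent) →
      (∀ (a x : Fin 4 → K), ∃ s : K, (fun r => t r (a, 0) (x, 0)) = s • v₀) →
      (∀ (b x : Fin 4 → K), ∃ s : K, (fun r => t r (0, b) (0, x)) = s • v₀') →
      (∃ a b y z : Fin 4 → K, ∑ r, c r * t r (a, 0) (y, 0) * t r (0, b) (0, z) ≠ 0) →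
      (∀ (a x : Fin 4 → K) r, t r (a, 0) (x, 0) = u₀ * (a 0 * x 1 + a 1 * x 0) * v₀ r) →
      ∀ k l : Fin 4, ((k = 0 ∧ l = 1) ∨ (k = 2 ∧ l = 3) ∨ (k = 0 ∧ l = 2) ∨ (k = 0 ∧ l = 3) ∨
        (k = 1 ∧ l = 2) ∨ (k = 1 ∧ l = 3)) →
      (∀ (b x : Fin 4 → K) r, t r (0, b) (0, x) = u₁ * (b k * x l + b l * x k) * v₀' r) →
      False := by
    intro t hJ hv₀ hv₀' hpeel hψ k l hkl hψ'
    rcases hkl with ⟨rfl, rfl⟩ | ⟨rfl, rfl⟩ | ⟨rfl, rfl⟩ | ⟨rfl, rfl⟩ | ⟨rfl, rfl⟩ | ⟨rfl, rfl⟩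
    · exact false_of_double_swap_same_pair hκ c hc t hJ v₀ v₀' hv₀ hv₀' hpeel u₀ u₁ hψ hψ'
    · exact false_of_swap01_core hκ c t hJ v₀ v₀' hv₀ hv₀' hpeel u₀ u₁ 2 3 (Or.inl ⟨rfl, rfl⟩) hψ hψ'
    · exact false_of_swap01_core hκ c t hJ v₀ v₀' hv₀ hv₀' hpeel u₀ u₁ 0 2 (Or.inr ⟨rfl, rfl⟩) hψ hψ'
    · -- `{0,3}`: transport along `(2 3)`
      obtain ⟨t', hJ', hw₀, hw₀', hpeel', hφ, hφ'⟩ :=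
        transport_swap (Equiv.swap 2 3) c t hJ v₀ v₀' hv₀ hv₀' hpeel u₀ u₁ 0 1 0 3 hψ hψ'
      have e0 : Equiv.swap (2 : Fin 4) 3 0 = 0 := by decide
      have e1 : Equiv.swap (2 : Fin 4) 3 1 = 1 := by decide
      have e3 : Equiv.swap (2 : Fin 4) 3 3 = 2 := by decide
      simp only [e0, e1, e3] at hφ hφ'
      exact false_of_swap01_core hκ c t' hJ' v₀ v₀' hw₀ hw₀' hpeel' u₀ u₁ 0 2 (Or.inr ⟨rfl, rfl⟩)
        hφ hφ'
    · -- `{1,2}`: transport along `(0 1)`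
      obtain ⟨t', hJ', hw₀, hw₀', hpeel', hφ, hφ'⟩ :=
        transport_swap (Equiv.swap 0 1) c t hJ v₀ v₀' hv₀ hv₀' hpeel u₀ u₁ 0 1 1 2 hψ hψ'
      have e0 : Equiv.swap (0 : Fin 4) 1 0 = 1 := by decide
      have e1 : Equiv.swap (0 : Fin 4) 1 1 = 0 := by decide
      have e2 : Equiv.swap (0 : Fin 4) 1 2 = 2 := by decide
      simp only [e0, e1, e2] at hφ hφ'
      exact false_of_swap01_core hκ c t' hJ' v₀ v₀' hw₀ hw₀' hpeel' u₀ u₁ 0 2 (Or.inr ⟨rfl, rfl⟩)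
        (fun a x r => by rw [hφ]; ring) hφ'
    · -- `{1,3}`: transport along `(0 1)(2 3)`
      obtain ⟨t', hJ', hw₀, hw₀', hpeel', hφ, hφ'⟩ :=
        transport_swap (Equiv.swap (0 : Fin 4) 1 * Equiv.swap (2 : Fin 4) 3) c t hJ v₀ v₀' hv₀
          hv₀' hpeel u₀ u₁ 0 1 1 3 hψ hψ'
      have e0 : (Equiv.swap (0 : Fin 4) 1 * Equiv.swap (2 : Fin 4) 3) 0 = 1 := by decide
      have e1 : (Equiv.swap (0 : Fin 4) 1 * Equiv.swap (2 : Fin 4) 3) 1 = 0 := by decide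
      have e3 : (Equiv.swap (0 : Fin 4) 1 * Equiv.swap (2 : Fin 4) 3) 3 = 2 := by decide
      simp only [e0, e1, e3] at hφ hφ'
      exact false_of_swap01_core hκ c t' hJ' v₀ v₀' hw₀ hw₀' hpeel' u₀ u₁ 0 2 (Or.inr ⟨rfl, rfl⟩)
        (fun a x r => by rw [hφ]; ring) hφ'
  -- reversed orders are the same correction
  have hψ'' : ∀ (b x : Fin 4 → K) r, t r (0, b) (0, x) = u₁ * (b l * x k + b k * x l) * v₀' r :=
    fun b x r => by rw [hψ']; ring
  fin_cases k <;> fin_cases l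
  all_goals first
    | exact absurd rfl hkl
    | exact norm t hJ hv₀ hv₀' hpeel hψ _ _ (by decide) hψ'
    | exact norm t hJ hv₀ hv₀' hpeel hψ _ _ (by decide) hψ''

/-- ★★ **The double-swap corner is empty for every pair of pairs.**  See the module docstring.
[folklore] -/
theorem false_of_double_swap [CharZero K] {κ : Type v} [Fintype κ] [DecidableEq κ]
    (hκ : Fintype.card κ ≤ 11) (c : κ → K) (hc : ∀ r, c r ≠ 0)
    (t : κ → (((Fin 4 → K) × (Fin 4 → K)) →ₗ[K] ((Fin 4 → K) × (Fin 4 → K)) →ₗ[K] K))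
    (hJ : ∀ a b y₂ y₃ : Fin 4 → K,
      ∑ r, c r * (t r (a, b) (y₂, y₃)) ^ 2 = (Matrix.of ![a, b, y₂, y₃]).permanent)
    (v₀ v₀' : κ → K) (hv₀ : ∀ (a x : Fin 4 → K), ∃ s : K, (fun r => t r (a, 0) (x, 0)) = s • v₀)
    (hv₀' : ∀ (b x : Fin 4 → K), ∃ s : K, (fun r => t r (0, b) (0, x)) = s • v₀')
    (hpeel : ∃ a b y z : Fin 4 → K, ∑ r, c r * t r (a, 0) (y, 0) * t r (0, b) (0, z) ≠ 0)
    (u₀ u₁ : K) (i j k l : Fin 4) (hij : i ≠ j) (hkl : k ≠ l)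
    (hψ : ∀ (a x : Fin 4 → K) r, t r (a, 0) (x, 0) = u₀ * (a i * x j + a j * x i) * v₀ r)
    (hψ' : ∀ (b x : Fin 4 → K) r, t r (0, b) (0, x) = u₁ * (b k * x l + b l * x k) * v₀' r) :
    False := by
  obtain ⟨π, hπi, hπj⟩ := exists_perm_01 i j hij
  obtain ⟨t', hJ', hw₀, hw₀', hpeel', hφ, hφ'⟩ :=
    transport_swap π c t hJ v₀ v₀' hv₀ hv₀' hpeel u₀ u₁ i j k l hψ hψ'
  simp only [hπi, hπj] at hφ
  exact false_of_swap01 hκ c hc t' hJ' v₀ v₀' hw₀ hw₀' hpeel' u₀ u₁ (π k) (π l)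
    (fun h => hkl (π.injective h)) hφ hφ'

/-- The bilinear form of the pure swap matrix `λ(E_ij + E_ji)`. [folklore] -/
theorem dotProduct_swap_mulVec (la : K) (i j : Fin 4) (a x : Fin 4 → K) :
    a ⬝ᵥ (la • (Matrix.single i j (1 : K) + Matrix.single j i 1)) *ᵥ x =
      la * (a i * x j + a j * x i) := by
  rw [Matrix.smul_mulVec, Matrix.add_mulVec, Matrix.single_mulVec_eq, Matrix.single_mulVec_eq,
    dotProduct_smul, dotProduct_add, dotProduct_smul, dotProduct_smul, dotProduct_single,
    dotProduct_single]
  simp only [smul_eq_mul, mul_one]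
  ring

/-- ★★ **Matrix currency.**  A reduced peeled family on `≤ 11` squares whose two correction
matrices are pure swaps `Ψ = λ(E_ij + E_ji)`, `Ψ′ = λ′(E_kl + E_lk)` does not exist — the form that
composes with `…TwoPencilFrameless.exists_frameless_pair_of_peeled`. [folklore] -/
theorem false_of_double_swap_matrix [CharZero K] {κ : Type v} [Fintype κ] [DecidableEq κ]
    (hκ : Fintype.card κ ≤ 11) (c : κ → K) (hc : ∀ r, c r ≠ 0)
    (t : κ → (((Fin 4 → K) × (Fin 4 → K)) →ₗ[K] ((Fin 4 → K) × (Fin 4 → K)) →ₗ[K] K))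
    (hJ : ∀ a b y₂ y₃ : Fin 4 → K,
      ∑ r, c r * (t r (a, b) (y₂, y₃)) ^ 2 = (Matrix.of ![a, b, y₂, y₃]).permanent)
    (v₀ v₀' : κ → K) (hv₀ : ∀ (a x : Fin 4 → K), ∃ s : K, (fun r => t r (a, 0) (x, 0)) = s • v₀)
    (hv₀' : ∀ (b x : Fin 4 → K), ∃ s : K, (fun r => t r (0, b) (0, x)) = s • v₀')
    (hpeel : ∃ a b y z : Fin 4 → K, ∑ r, c r * t r (a, 0) (y, 0) * t r (0, b) (0, z) ≠ 0)
    (Ψ Ψ' : Matrix (Fin 4) (Fin 4) K)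
    (hΨ : ∀ (a x : Fin 4 → K) (r : κ), t r (a, 0) (x, 0) = (a ⬝ᵥ Ψ *ᵥ x) * v₀ r)
    (hΨ' : ∀ (b x : Fin 4 → K) (r : κ), t r (0, b) (0, x) = (b ⬝ᵥ Ψ' *ᵥ x) * v₀' r)
    (la la' : K) (i j k l : Fin 4) (hij : i ≠ j) (hkl : k ≠ l)
    (hΨeq : Ψ = la • (Matrix.single i j (1 : K) + Matrix.single j i 1))
    (hΨ'eq : Ψ' = la' • (Matrix.single k l (1 : K) + Matrix.single l k 1)) : False :=
  false_of_double_swap hκ c hc t hJ v₀ v₀' hv₀ hv₀' hpeel la la' i j k l hij hkl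
    (fun a x r => by rw [hΨ, hΨeq, dotProduct_swap_mulVec])
    (fun b x r => by rw [hΨ', hΨ'eq, dotProduct_swap_mulVec])

end Summit.ValiantsHypothesis.ValiantsHypothesis.Theorems.SymPencilPerFourPeeledCornerSwapAll

end
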